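import Mathlib
import Summits.Ventures.HodgeRepro.Tier4.Line4.LevelIndexBound

/-!
# Tier4/Line4/LevelIndexCount — the index bound in COUNT form: `K(pⁿ) γ₀ K(pⁿ)` is covered by `M` left translates of
`K(pⁿ)`, `M` free of `n`

Blind re-derivation cell `pub-hodge-repro`, Tier 4 «prove the step» (README §9–§10), seat t4-L4-p2 (prover, LINE L4,
gen 4; the owed COUNT form of crit-2 g8's Entry 284, S15448 — «the index bound of record is a MEASURE inequality and
bounds the cardinality of no cover»).  Tree path `lean/Summits/Ventures/HodgeRepro/Tier4/Line4/LevelIndexCount.lean`.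
No `def`; no literature.

THE STATEMENT.  `exists_finset_cover_levelDoubleCoset`: for `γ₀ ∈ G(𝔸_f)` with `γ₀`, `γ₀⁻¹` `v`-integral at the places
`v ∣ p` (the hypothesis of `LevelIndexBound.levelDoubleCoset_measure_le`, met by L1-p1's `exists_levelPrime`), there is
`M : ℕ` such that for EVERY `n` some `reps : Finset (GA W)` with `reps.card ≤ M` has
`levelDoubleCoset W (pⁿ) γ₀ ⊆ ⋃ g ∈ reps, g • K(pⁿ)` — the `reps`/`hcov` binder of L2-p1's `RatioReduce`
(`suppMeasure_le_of_tProjection`, S15442) with `reps.card` bounded uniformly in `n`, so the glue's `C′` is free of `N`.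

THE PROOF is the cover of `LevelIndexBound` made explicit: `K(1) ⊆ ⋃_{κ∈t} κ K′` with `K′ = K(1) ∩ γ₀ K(1) γ₀⁻¹` open and
`t` independent of `n`; for each `κ ∈ t` whose piece `K(pⁿ) ∩ κK′` is non-empty pick `x_κ` in it and put
`g_κ := x_κ γ₀` (else `g_κ := 1`); then `K(pⁿ) γ₀ K(pⁿ) ⊆ ⋃_{κ∈t} g_κ K(pⁿ)` by the conjugation lemma
`mem_levelK_conj` (`x_κ⁻¹ κ₁ ∈ K(pⁿ) ∩ K′` ⇒ `γ₀⁻¹ (x_κ⁻¹ κ₁) γ₀ ∈ K(pⁿ)`), and `#(t.image g) ≤ #t =: M`.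

Nothing here says anything about the status of the Hodge conjecture for CM abelian varieties, which is NOT proved
(HC_CM is NOT proved by anyone in this repository).
-/

set_option autoImplicit false

noncomputable section

namespace Summit.Ventures.HodgeRepro.Tier4.Line4

open Summit.Ventures.HodgeRepro.Tier4.Common Summit.Ventures.HodgeRepro.Tier4.Line1 MeasureTheory NumberField
  IsDedekindDomain Topology

open scoped Pointwise ENNReal

section Count

variable {k : Type} [Field k] [NumberField k] (W : PlaneData k)

/-- **THE INDEX BOUND, COUNT FORM**: for `γ₀ ∈ G(𝔸_f)` integral with integral inverse at the places above `p`, every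
double coset `K(pⁿ) γ₀ K(pⁿ)` is covered by at most `M` left translates `g K(pⁿ)`, with ONE `M` for every `n` (the same
cover as `levelDoubleCoset_measure_le`: `M` = the number of translates of `K(1) ∩ γ₀ K(1) γ₀⁻¹` covering `K(1)`). -/
theorem exists_finset_cover_levelDoubleCoset {γ₀ : GA W} (hγ₀f : γ₀ ∈ finitePart W) (p : ℕ)
    (hγ₀ : ∀ v : HeightOneSpectrum (𝓞 k), (p : 𝓞 k) ∈ v.asIdeal → ∀ i j, Valued.v (finPart k (GA.mat W γ₀ i j) v) ≤ 1)
    (hγ₀' : ∀ v : HeightOneSpectrum (𝓞 k), (p : 𝓞 k) ∈ v.asIdeal → ∀ i j,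
      Valued.v (finPart k (GA.mat W γ₀⁻¹ i j) v) ≤ 1) :
    ∃ M : ℕ, ∀ n : ℕ, ∃ reps : Finset (GA W), reps.card ≤ M ∧
      levelDoubleCoset W (p ^ n) γ₀ ⊆ ⋃ g ∈ reps, g • (levelK W (p ^ n) : Set (GA W)) := by
  classical
  -- `K′ = K(1) ∩ γ₀ K(1) γ₀⁻¹`, open in `G(𝔸_f)`, a subgroup
  set K' : Set (finitePart W) :=
    {y | (y : GA W) ∈ levelK W 1 ∧ γ₀⁻¹ * (y : GA W) * γ₀ ∈ levelK W 1} with hK'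
  have hK'o : IsOpen K' := by
    refine IsOpen.inter ?_ ?_
    · exact isOpen_preimage_levelK_of_continuous W one_ne_zero continuous_subtype_val fun y => y.2
    · refine isOpen_preimage_levelK_of_continuous W one_ne_zero
        ((continuous_const.mul continuous_subtype_val).mul continuous_const) fun y => ?_
      exact Subgroup.mul_mem _ (Subgroup.mul_mem _ (Subgroup.inv_mem _ hγ₀f) y.2) hγ₀f
  have hK'1 : (1 : finitePart W) ∈ K' := by
    refine ⟨Subgroup.one_mem _, ?_⟩
    simp only [Subgroup.coe_one, mul_one, inv_mul_cancel]
    exact Subgroup.one_mem _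
  have hK'div : ∀ a ∈ K', ∀ b ∈ K', a⁻¹ * b ∈ K' := by
    intro a ha b hb
    refine ⟨?_, ?_⟩
    · rw [Subgroup.coe_mul, Subgroup.coe_inv]
      exact Subgroup.mul_mem _ (Subgroup.inv_mem _ ha.1) hb.1
    · have : γ₀⁻¹ * ((a⁻¹ * b : finitePart W) : GA W) * γ₀ =
          (γ₀⁻¹ * (a : GA W) * γ₀)⁻¹ * (γ₀⁻¹ * (b : GA W) * γ₀) := by
        rw [Subgroup.coe_mul, Subgroup.coe_inv]
        group
      rw [this]
      exact Subgroup.mul_mem _ (Subgroup.inv_mem _ ha.2) hb.2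
  -- the finite cover of the compact `K(1)` by translates of `K′`
  have hK1c : IsCompact {y : finitePart W | (y : GA W) ∈ levelK W 1} :=
    isCompact_coe_mem_levelK_finitePart W one_ne_zero
  obtain ⟨t, -, ht⟩ := hK1c.elim_nhds_subcover (fun κ : finitePart W => {y | κ⁻¹ * y ∈ K'}) fun κ _ => by
    refine (hK'o.preimage (continuous_const.mul continuous_id)).mem_nhds ?_
    show κ⁻¹ * κ ∈ K'
    rw [inv_mul_cancel]
    exact hK'1
  refine ⟨t.card, fun n => ?_⟩
  set KN : Set (finitePart W) := {y | (y : GA W) ∈ levelK W (p ^ n)} with hKN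
  -- the representative of the piece of `κ`: a point of `K(pⁿ) ∩ κ K′` times `γ₀` (or `1` if the piece is empty)
  set g : finitePart W → GA W := fun κ =>
    if h : ∃ x ∈ KN, κ⁻¹ * x ∈ K' then (h.choose : GA W) * γ₀ else 1 with hg
  refine ⟨t.image g, Finset.card_image_le, fun y hy => ?_⟩
  obtain ⟨_, ⟨κ₁, hκ₁, g₀, hg₀, rfl⟩, κ₂, hκ₂, hyeq⟩ := hy
  rw [Set.mem_singleton_iff] at hg₀
  rw [hg₀] at hyeq
  have hκ₁f : κ₁ ∈ finitePart W := levelK_le_finitePart W _ hκ₁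
  set x : finitePart W := ⟨κ₁, hκ₁f⟩ with hx
  have hxK1 : x ∈ {y : finitePart W | (y : GA W) ∈ levelK W 1} :=
    Line1.levelK_antitone W (one_dvd _) hκ₁
  obtain ⟨κ, hκt, hκ⟩ := Set.mem_iUnion₂.mp (ht hxK1)
  have hex : ∃ x ∈ KN, κ⁻¹ * x ∈ K' := ⟨x, hκ₁, hκ⟩
  obtain ⟨hx₀, hκx₀⟩ := hex.choose_spec
  set x₀ : finitePart W := hex.choose with hx₀def
  have hgκ : g κ = (x₀ : GA W) * γ₀ := by
    simp only [hg, dif_pos hex]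
    rfl
  refine Set.mem_iUnion₂.mpr ⟨g κ, Finset.mem_image_of_mem g hκt, ?_⟩
  rw [hgκ, Set.mem_smul_set_iff_inv_smul_mem, smul_eq_mul]
  -- `(x₀ γ₀)⁻¹ y = γ₀⁻¹ (x₀⁻¹ κ₁) γ₀ · κ₂`, with `x₀⁻¹ κ₁ ∈ K(pⁿ) ∩ K′`
  have hz : x₀⁻¹ * x ∈ KN := by
    show (((x₀⁻¹ * x : finitePart W)) : GA W) ∈ levelK W (p ^ n)
    rw [Subgroup.coe_mul, Subgroup.coe_inv]
    exact Subgroup.mul_mem _ (Subgroup.inv_mem _ hx₀) hκ₁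
  have hzK' : x₀⁻¹ * x ∈ K' := by
    have := hK'div _ hκx₀ _ hκ
    rwa [mul_inv_rev, inv_inv, mul_assoc, mul_inv_cancel_left] at this
  have hconj : γ₀⁻¹ * ((x₀⁻¹ * x : finitePart W) : GA W) * γ₀ ∈ levelK W (p ^ n) :=
    mem_levelK_conj W p n hγ₀ hγ₀' hz hzK'.2
  have heq : ((x₀ : GA W) * γ₀)⁻¹ * y = (γ₀⁻¹ * ((x₀⁻¹ * x : finitePart W) : GA W) * γ₀) * κ₂ := by
    rw [← hyeq, Subgroup.coe_mul, Subgroup.coe_inv, hx]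
    show (↑x₀ * γ₀)⁻¹ * (κ₁ * γ₀ * κ₂) = γ₀⁻¹ * ((↑x₀)⁻¹ * κ₁) * γ₀ * κ₂
    group
  rw [heq]
  exact Subgroup.mul_mem _ hconj hκ₂

end Count

end Summit.Ventures.HodgeRepro.Tier4.Line4

end
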